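import Mathlib.Analysis.SpecialFunctions.Stirling
import Mathlib.Analysis.SpecialFunctions.BinaryEntropy
import Mathlib.Analysis.SpecialFunctions.Log.NegMulLog
import Mathlib.Analysis.SpecialFunctions.Log.Deriv
import Mathlib.Analysis.Calculus.Deriv.MeanValue
import Mathlib.Data.Nat.Choose.Sum
import HarnessLib

/-!
# Binomial coefficients against the rate function of a fair `±1` spin

Support file for the discharge of `Literature.Probability.LatticeModels.isIsingLimitLaw_phi4`
(Simon–Griffiths 1973, Thm. 1: `exp(-a u⁴ - b u²) du` is an Ising limit law), following §2 of

* B. Simon, R. B. Griffiths, *The (φ⁴)₂ field theory as a classical Ising model*, Commun. Math.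
  Phys. **33** (1973) 145–164, doi:10.1007/bf01645626 — bib key `SimonGriffiths1973` (the same paper
  as the tree's interim stub key `GriffithsSimon1973` cited by `IsingLimitLaw.lean`), §2,
  Lemmas 1–3 (pp. 149–150).

## Contents

* `spinRate x = ½[(1+x) log(1+x) + (1-x) log(1-x)]` — the function `h` of [SimonGriffiths1973,
  §2, eq. (2)] (Cramér rate function of a fair `±1` spin). It is Mathlib's binary entropy
  reparametrised: `spinRate x = log 2 - Real.binEntropy ((1+x)/2)`
  (`spinRate_eq_log_two_sub_binEntropy`, all `x`, with Mathlib's `log 0 = 0`); its derivatives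
  `½ (log(1+x) - log(1-x))` and `1/(1-x²)` on `(-1, 1)` (`hasDerivAt_spinRate`,
  `hasDerivAt_deriv_spinRate`).
* Lemma 3: `x²/2 + x⁴/12 ≤ h(x)` on `[-1, 1]` (`sq_add_pow_four_le_spinRate`) and the quantitative
  form of `h(x) - x²/2 - x⁴/12 = o(x⁴)`: `h(x) ≤ x²/2 + x⁴/12 + x⁶/15` on `[-1/2, 1/2]`
  (`spinRate_le_taylor`). Both by monotonicity from the sign of a derivative, twice.
* Lemmas 1–2 (Stirling) in the form the tree's Mathlib offers: with `s = Stirling.stirlingSeq`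
  (`n! = s(n) √(2n) exp(n log n - n)` for `n ≥ 1`, `factorial_eq_stirlingSeq_mul`; `√π ≤ s(n) ≤ e/√2`,
  `s(n) → √π`), the entropy identity in logarithmic form
  `p log p + (N-p) log(N-p) = N log N - N log 2 + N h((2p-N)/N)` for real `0 < p < N`
  (`mul_log_add_mul_log_eq_spinRate`), its exponential form
  `exp(N log N - j log j - (N-j) log(N-j)) = 2ᴺ exp(-N h((2j-N)/N))` for natural `1 ≤ j ≤ N - 1`
  (`exp_entropy_eq`; the endpoints `j = 0, N` are the values `h(∓1) = log 2`, `spinRate_neg_one`,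
  `spinRate_one`), the Stirling form for `1 ≤ j ≤ N - 1`
  `C(N, j) = [s(N)/(s(j) s(N-j))] · √(N / (2 j (N-j))) · (2ᴺ exp(-N h((2j-N)/N)))`
  (`choose_eq_stirlingRatio`, with `stirlingRatio N j = s(N)/(s(j) s(N-j))`), the crude bound
  `C(N, j) ≤ 2ᴺ exp(-N h((2j-N)/N))` for ALL `0 ≤ j ≤ N` (`choose_le_exp_spinRate`: the term `m = j`
  of the binomial expansion of `1 = (j/N + (N-j)/N)ᴺ` — the same one-term argument as the tree's
  van Lint bound `Literature.Combinatorics.exp_neg_mul_binEntropy_le_weight` /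
  `vanLint_sum_choose_le_exp_binEntropy` in `Literature/Combinatorics/BinomialEntropyBound.lean`,
  there in `binEntropy` form for the lower tail), the two-sided bounds
  `0 < s(N)/(s(j)s(N-j)) ≤ e/(√2 π)` (`stirlingRatio_pos`, `stirlingRatio_le`) and the limit
  `s(N)/(s(j)s(N-j)) → 1/√π` as `j, N - j → ∞` (`tendsto_stirlingRatio`).

## Not here

The de Moivre–Laplace theorem itself (only the pieces above are needed downstream); no measure
theory. The calculus is done on `spinRate` directly (not through `Real.binEntropy`'s API) because
the statements downstream are in the spin variable `x = 2p - 1`; the bridge lemma ties the two.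
-/

noncomputable section

open Real Filter Topology Set

namespace Literature.Probability.LatticeModels

/-! ### The rate function `h` -/

/-- The rate function of a fair `±1` spin, `h(x) = ½[(1+x) log(1+x) + (1-x) log(1-x)]`
(with Mathlib's `log 0 = 0`, so `h(±1) = log 2`). [cite: SimonGriffiths1973, §2 eq. (2)] -/
def spinRate (x : ℝ) : ℝ :=
  ((1 + x) * Real.log (1 + x) + (1 - x) * Real.log (1 - x)) / 2

/-- `h(0) = 0`. [folklore] -/
@[simp] theorem spinRate_zero : spinRate 0 = 0 := by simp [spinRate]

/-- `h` is even. [folklore] -/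
theorem spinRate_neg (x : ℝ) : spinRate (-x) = spinRate x := by
  simp only [spinRate, ← sub_eq_add_neg, sub_neg_eq_add]; ring

/-- `h(1) = log 2`. [folklore] -/
theorem spinRate_one : spinRate 1 = Real.log 2 := by norm_num [spinRate]

/-- `h` is continuous on `ℝ` (as `t log t` is). [folklore] -/
theorem continuous_spinRate : Continuous spinRate := by
  unfold spinRate
  fun_prop (disch := exact Real.continuous_mul_log)

/-- **Bridge to Mathlib**: `h(x) = log 2 - binEntropy((1+x)/2)` for all `x` (both sides use
`log 0 = 0` at `x = ±1`). [folklore] -/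
theorem spinRate_eq_log_two_sub_binEntropy (x : ℝ) :
    spinRate x = Real.log 2 - Real.binEntropy ((1 + x) / 2) := by
  have e : 1 - (1 + x) / 2 = (1 - x) / 2 := by ring
  rw [Real.binEntropy, e, Real.log_inv, Real.log_inv]
  rcases eq_or_ne (1 + x) 0 with h1 | h1
  · have hx : x = -1 := by linarith
    subst hx; norm_num [spinRate]
  rcases eq_or_ne (1 - x) 0 with h2 | h2
  · have hx : x = 1 := by linarith
    subst hx; norm_num [spinRate]
  rw [Real.log_div h1 two_ne_zero, Real.log_div h2 two_ne_zero, spinRate]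
  ring

/-- `h'(x) = ½ (log(1+x) - log(1-x))` on `(-1, 1)`. [cite: SimonGriffiths1973, §2 Lemma 3] -/
theorem hasDerivAt_spinRate {x : ℝ} (hx₁ : -1 < x) (hx₂ : x < 1) :
    HasDerivAt spinRate ((Real.log (1 + x) - Real.log (1 - x)) / 2) x := by
  have ha : HasDerivAt (fun y : ℝ => 1 + y) 1 x := (hasDerivAt_id x).const_add 1
  have hb : HasDerivAt (fun y : ℝ => 1 - y) (-1) x := by
    simpa using (hasDerivAt_id x).const_sub 1
  have h1 : HasDerivAt (fun y : ℝ => (1 + y) * Real.log (1 + y)) (Real.log (1 + x) + 1) x := by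
    have := (Real.hasDerivAt_mul_log (by linarith : (1 + x) ≠ 0)).comp x ha
    simpa [Function.comp_def] using this
  have h2 : HasDerivAt (fun y : ℝ => (1 - y) * Real.log (1 - y)) (-(Real.log (1 - x) + 1)) x := by
    have := (Real.hasDerivAt_mul_log (by linarith : (1 - x) ≠ 0)).comp x hb
    simpa [Function.comp_def] using this
  show HasDerivAt (fun y => ((1 + y) * Real.log (1 + y) + (1 - y) * Real.log (1 - y)) / 2) _ x
  refine ((h1.add h2).div_const 2).congr_deriv ?_
  ring

/-- `(½ (log(1+x) - log(1-x)))' = 1/(1-x²)` on `(-1, 1)`, i.e. `h'' = 1/(1-x²)`.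
[cite: SimonGriffiths1973, §2 Lemma 3] -/
theorem hasDerivAt_deriv_spinRate {x : ℝ} (hx₁ : -1 < x) (hx₂ : x < 1) :
    HasDerivAt (fun y => (Real.log (1 + y) - Real.log (1 - y)) / 2) (1 / (1 - x ^ 2)) x := by
  have ha : HasDerivAt (fun y : ℝ => 1 + y) 1 x := (hasDerivAt_id x).const_add 1
  have hb : HasDerivAt (fun y : ℝ => 1 - y) (-1) x := by
    simpa using (hasDerivAt_id x).const_sub 1
  have h1 : HasDerivAt (fun y : ℝ => Real.log (1 + y)) (1 / (1 + x)) x := by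
    have := (Real.hasDerivAt_log (by linarith : (1 + x) ≠ 0)).comp x ha
    simpa [Function.comp_def] using this
  have h2 : HasDerivAt (fun y : ℝ => Real.log (1 - y)) (-(1 / (1 - x))) x := by
    have := (Real.hasDerivAt_log (by linarith : (1 - x) ≠ 0)).comp x hb
    simpa [Function.comp_def, div_eq_mul_inv] using this
  refine ((h1.sub h2).div_const 2).congr_deriv ?_
  have h3 : (1 + x) ≠ 0 := by linarith
  have h4 : (1 - x) ≠ 0 := by linarith
  have h5 : (1 - x ^ 2) ≠ 0 := by
    have : 1 - x ^ 2 = (1 + x) * (1 - x) := by ring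
    rw [this]; exact mul_ne_zero h3 h4
  field_simp
  ring

/-- The derivative of `F' = h' - x - x³/3` is `x⁴/(1-x²)` on `(-1, 1)`. [folklore] -/
theorem hasDerivAt_spinRate_aux₁ {y : ℝ} (hy₁ : -1 < y) (hy₂ : y < 1) :
    HasDerivAt (fun y => (Real.log (1 + y) - Real.log (1 - y)) / 2 - y - y ^ 3 / 3)
      (y ^ 4 / (1 - y ^ 2)) y := by
  have hd := ((hasDerivAt_deriv_spinRate hy₁ hy₂).sub (hasDerivAt_id y)).sub
    ((hasDerivAt_pow 3 y).div_const 3)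
  refine hd.congr_deriv ?_
  have : 1 - y ^ 2 ≠ 0 := by nlinarith
  field_simp
  norm_num
  ring

/-- The derivative of `G' = x + x³/3 + 2x⁵/5 - h'` is `1 + x² + 2x⁴ - 1/(1-x²)` on `(-1, 1)`.
[folklore] -/
theorem hasDerivAt_spinRate_aux₂ {y : ℝ} (hy₁ : -1 < y) (hy₂ : y < 1) :
    HasDerivAt (fun y => y + y ^ 3 / 3 + 2 * y ^ 5 / 5 - (Real.log (1 + y) - Real.log (1 - y)) / 2)
      (1 + y ^ 2 + 2 * y ^ 4 - 1 / (1 - y ^ 2)) y := by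
  have hd := (((hasDerivAt_id y).add ((hasDerivAt_pow 3 y).div_const 3)).add
    (((hasDerivAt_pow 5 y).const_mul 2).div_const 5)).sub (hasDerivAt_deriv_spinRate hy₁ hy₂)
  refine hd.congr_deriv ?_
  norm_num
  ring

/-- **Lemma 3 (a)**: `x²/2 + x⁴/12 ≤ h(x)` for `x ∈ [-1, 1]` (all Taylor coefficients of `h` are
non-negative; here: `F = h - x²/2 - x⁴/12` has `F(0) = F'(0) = 0` and `F'' = x⁴/(1-x²) ≥ 0`).
[cite: SimonGriffiths1973, §2 Lemma 3(a)] -/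
theorem sq_add_pow_four_le_spinRate {x : ℝ} (hx : x ∈ Icc (-1 : ℝ) 1) :
    x ^ 2 / 2 + x ^ 4 / 12 ≤ spinRate x := by
  wlog h0 : 0 ≤ x generalizing x
  · have := this (x := -x) ⟨by linarith [hx.2], by linarith [hx.1]⟩ (by linarith)
    have e2 : (-x) ^ 2 = x ^ 2 := by ring
    have e4 : (-x) ^ 4 = x ^ 4 := by ring
    rwa [spinRate_neg, e2, e4] at this
  -- the first derivative `F'` of `F` is non-negative on `[0, 1)`
  have hF'mono : MonotoneOn (fun y => (Real.log (1 + y) - Real.log (1 - y)) / 2 - y - y ^ 3 / 3)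
      (Ico 0 1) := by
    refine monotoneOn_of_hasDerivWithinAt_nonneg (convex_Ico 0 1)
      (f' := fun y => y ^ 4 / (1 - y ^ 2)) ?_ ?_ ?_
    · have h'' : ∀ y ∈ Ico (0 : ℝ) 1, 1 - y ≠ 0 := fun y hy => by linarith [hy.2]
      have h' : ∀ y ∈ Ico (0 : ℝ) 1, 1 + y ≠ 0 := fun y hy => by linarith [hy.1]
      refine ContinuousOn.sub (ContinuousOn.sub (ContinuousOn.div_const (ContinuousOn.sub ?_ ?_) _)
        continuousOn_id) (by fun_prop)
      · exact continuousOn_of_forall_continuousAt fun y hy =>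
          (Real.continuousAt_log (h' y hy)).comp (by fun_prop)
      · exact continuousOn_of_forall_continuousAt fun y hy =>
          (Real.continuousAt_log (h'' y hy)).comp (by fun_prop)
    · intro y hy
      rw [interior_Ico] at hy
      exact (hasDerivAt_spinRate_aux₁ (by linarith [hy.1]) hy.2).hasDerivWithinAt
    · intro y hy
      rw [interior_Ico] at hy
      have : 0 < 1 - y ^ 2 := by nlinarith [hy.1, hy.2]
      positivity
  have hF'nonneg : ∀ y ∈ Ico (0 : ℝ) 1,
      0 ≤ (Real.log (1 + y) - Real.log (1 - y)) / 2 - y - y ^ 3 / 3 := fun y hy => by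
    have := hF'mono (show (0 : ℝ) ∈ Ico (0 : ℝ) 1 from ⟨le_rfl, zero_lt_one⟩) hy hy.1
    simpa using this
  -- hence `F` is monotone on `[0, 1]`
  have hFmono : MonotoneOn (fun y => spinRate y - y ^ 2 / 2 - y ^ 4 / 12) (Icc 0 1) := by
    refine monotoneOn_of_hasDerivWithinAt_nonneg (convex_Icc 0 1)
      (f' := fun y => (Real.log (1 + y) - Real.log (1 - y)) / 2 - y - y ^ 3 / 3) ?_ ?_ ?_
    · exact (continuous_spinRate.continuousOn.sub (by fun_prop)).sub (by fun_prop)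
    · intro y hy
      rw [interior_Icc] at hy
      have hd := ((hasDerivAt_spinRate (by linarith [hy.1]) hy.2).sub
        ((hasDerivAt_pow 2 y).div_const 2)).sub ((hasDerivAt_pow 4 y).div_const 12)
      refine (hd.congr_deriv ?_).hasDerivWithinAt
      norm_num
      ring
    · intro y hy
      rw [interior_Icc] at hy
      exact hF'nonneg y ⟨hy.1.le, hy.2⟩
  have := hFmono (show (0 : ℝ) ∈ Icc (0 : ℝ) 1 from ⟨le_rfl, zero_le_one⟩) ⟨h0, hx.2⟩ h0
  simp only [spinRate_zero] at this
  linarith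

/-- **Lemma 3 (b)**, quantitative: `h(x) ≤ x²/2 + x⁴/12 + x⁶/15` for `|x| ≤ 1/2` (so
`h(x) - x²/2 - x⁴/12 = o(x⁴)` at `0`); `G = x²/2 + x⁴/12 + x⁶/15 - h` has `G(0) = G'(0) = 0` and
`G'' = 1 + x² + 2x⁴ - 1/(1-x²) ≥ 0` for `x² ≤ 1/4`. [cite: SimonGriffiths1973, §2 Lemma 3(b)] -/
theorem spinRate_le_taylor {x : ℝ} (hx : x ∈ Icc (-(1 / 2) : ℝ) (1 / 2)) :
    spinRate x ≤ x ^ 2 / 2 + x ^ 4 / 12 + x ^ 6 / 15 := by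
  wlog h0 : 0 ≤ x generalizing x
  · have := this (x := -x) ⟨by linarith [hx.2], by linarith [hx.1]⟩ (by linarith)
    have e2 : (-x) ^ 2 = x ^ 2 := by ring
    have e4 : (-x) ^ 4 = x ^ 4 := by ring
    have e6 : (-x) ^ 6 = x ^ 6 := by ring
    rwa [spinRate_neg, e2, e4, e6] at this
  have hG'mono : MonotoneOn
      (fun y => y + y ^ 3 / 3 + 2 * y ^ 5 / 5 - (Real.log (1 + y) - Real.log (1 - y)) / 2)
      (Icc 0 (1 / 2)) := by
    refine monotoneOn_of_hasDerivWithinAt_nonneg (convex_Icc 0 (1 / 2))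
      (f' := fun y => 1 + y ^ 2 + 2 * y ^ 4 - 1 / (1 - y ^ 2)) ?_ ?_ ?_
    · have h'' : ∀ y ∈ Icc (0 : ℝ) (1 / 2), 1 - y ≠ 0 := fun y hy => by linarith [hy.2]
      have h' : ∀ y ∈ Icc (0 : ℝ) (1 / 2), 1 + y ≠ 0 := fun y hy => by linarith [hy.1]
      refine ContinuousOn.sub (by fun_prop) (ContinuousOn.div_const (ContinuousOn.sub ?_ ?_) _)
      · exact continuousOn_of_forall_continuousAt fun y hy =>
          (Real.continuousAt_log (h' y hy)).comp (by fun_prop)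
      · exact continuousOn_of_forall_continuousAt fun y hy =>
          (Real.continuousAt_log (h'' y hy)).comp (by fun_prop)
    · intro y hy
      rw [interior_Icc] at hy
      exact (hasDerivAt_spinRate_aux₂ (by linarith [hy.1]) (by linarith [hy.2])).hasDerivWithinAt
    · intro y hy
      rw [interior_Icc] at hy
      have h1 : 0 < 1 - y ^ 2 := by nlinarith [hy.1, hy.2]
      have h2 : y ^ 2 ≤ 1 / 4 := by nlinarith [hy.1, hy.2]
      rw [sub_nonneg, div_le_iff₀ h1]
      nlinarith [sq_nonneg y, sq_nonneg (y ^ 2)]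
  have hG'nonneg : ∀ y ∈ Icc (0 : ℝ) (1 / 2),
      0 ≤ y + y ^ 3 / 3 + 2 * y ^ 5 / 5 - (Real.log (1 + y) - Real.log (1 - y)) / 2 := fun y hy => by
    have := hG'mono (show (0 : ℝ) ∈ Icc (0 : ℝ) (1 / 2) from ⟨le_rfl, by norm_num⟩) hy hy.1
    simpa using this
  have hGmono : MonotoneOn (fun y => y ^ 2 / 2 + y ^ 4 / 12 + y ^ 6 / 15 - spinRate y)
      (Icc 0 (1 / 2)) := by
    refine monotoneOn_of_hasDerivWithinAt_nonneg (convex_Icc 0 (1 / 2))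
      (f' := fun y => y + y ^ 3 / 3 + 2 * y ^ 5 / 5 - (Real.log (1 + y) - Real.log (1 - y)) / 2)
      ?_ ?_ ?_
    · exact (Continuous.continuousOn (by fun_prop)).sub continuous_spinRate.continuousOn
    · intro y hy
      rw [interior_Icc] at hy
      have hd := ((((hasDerivAt_pow 2 y).div_const 2).add ((hasDerivAt_pow 4 y).div_const 12)).add
        ((hasDerivAt_pow 6 y).div_const 15)).sub
        (hasDerivAt_spinRate (by linarith [hy.1]) (by linarith [hy.2]))
      refine (hd.congr_deriv ?_).hasDerivWithinAt
      norm_num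
      ring
    · intro y hy
      rw [interior_Icc] at hy
      exact hG'nonneg y ⟨hy.1.le, hy.2.le⟩
  have := hGmono (show (0 : ℝ) ∈ Icc (0 : ℝ) (1 / 2) from ⟨le_rfl, by norm_num⟩) ⟨h0, hx.2⟩ h0
  simp only [spinRate_zero] at this
  linarith

/-! ### The entropy identity and binomial coefficients -/

/-- The logarithmic form of `jʲ (N-j)ᴺ⁻ʲ = Nᴺ 2⁻ᴺ e^{N h((2j-N)/N)}` for real `0 < p < N`:
`p log p + (N-p) log(N-p) = N log N - N log 2 + N h((2p-N)/N)`. [cite: SimonGriffiths1973, §2 Lemma 2] -/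
theorem mul_log_add_mul_log_eq_spinRate {N p : ℝ} (hp : 0 < p) (hpN : p < N) :
    p * Real.log p + (N - p) * Real.log (N - p) =
      N * Real.log N - N * Real.log 2 + N * spinRate ((2 * p - N) / N) := by
  have hN : 0 < N := hp.trans hpN
  have hq : 0 < N - p := sub_pos.2 hpN
  have e1 : 1 + (2 * p - N) / N = 2 * p / N := by field_simp; ring
  have e2 : 1 - (2 * p - N) / N = 2 * (N - p) / N := by field_simp; ring
  simp only [spinRate, e1, e2]
  rw [Real.log_div (by positivity) hN.ne', Real.log_div (by positivity) hN.ne',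
    Real.log_mul two_ne_zero hp.ne', Real.log_mul two_ne_zero hq.ne']
  field_simp
  ring

/-- For natural `1 ≤ j ≤ N - 1`: `jʲ (N-j)ᴺ⁻ʲ`-free form of the entropy identity,
`exp(N log N - j log j - (N-j) log(N-j)) = 2ᴺ exp(-N h((2j-N)/N))`. [cite: SimonGriffiths1973, §2 Lemma 2] -/
theorem exp_entropy_eq {N j : ℕ} (hj : 1 ≤ j) (hjN : j + 1 ≤ N) :
    Real.exp (N * Real.log N - j * Real.log j - ((N : ℝ) - j) * Real.log ((N : ℝ) - j)) =
      2 ^ N * Real.exp (-(N * spinRate ((2 * j - N) / N))) := by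
  have hp : (0 : ℝ) < j := by exact_mod_cast hj
  have hpN : (j : ℝ) < N := by exact_mod_cast hjN
  have key := mul_log_add_mul_log_eq_spinRate hp hpN
  have : (N : ℝ) * Real.log N - j * Real.log j - ((N : ℝ) - j) * Real.log ((N : ℝ) - j) =
      N * Real.log 2 + -(N * spinRate ((2 * j - N) / N)) := by linarith
  rw [this, Real.exp_add, Real.exp_nat_mul, Real.exp_log two_pos]

/-- `n! = s(n) · √(2n) · exp(n log n - n)` for `n ≥ 1`, `s = Stirling.stirlingSeq`. [folklore] -/
theorem factorial_eq_stirlingSeq_mul {n : ℕ} (hn : n ≠ 0) :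
    (n.factorial : ℝ) =
      Stirling.stirlingSeq n * Real.sqrt (2 * n) * Real.exp (n * Real.log n - n) := by
  have hn' : (0 : ℝ) < n := by exact_mod_cast Nat.pos_of_ne_zero hn
  have hpow : ((n : ℝ) / Real.exp 1) ^ n = Real.exp (n * Real.log n - n) := by
    rw [div_pow, ← Real.exp_nat_mul, mul_one, ← Real.exp_log (pow_pos hn' n), ← Real.exp_sub,
      Real.log_pow]
  have hden : Real.sqrt (2 * n) * ((n : ℝ) / Real.exp 1) ^ n ≠ 0 := by positivity
  rw [Stirling.stirlingSeq, mul_assoc, hpow, ← hpow, div_mul_cancel₀ _ hden]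

/-- The Stirling correction ratio `s(N) / (s(j) s(N-j))` of a binomial coefficient,
`s = Stirling.stirlingSeq`. [folklore] -/
def stirlingRatio (N j : ℕ) : ℝ :=
  Stirling.stirlingSeq N / (Stirling.stirlingSeq j * Stirling.stirlingSeq (N - j))

/-- `√π ≤ s(n)` for `n ≥ 1` (Mathlib). [folklore] -/
theorem sqrt_pi_le_stirlingSeq' {n : ℕ} (hn : n ≠ 0) : Real.sqrt π ≤ Stirling.stirlingSeq n :=
  Stirling.sqrt_pi_le_stirlingSeq hn

/-- `s(n) ≤ s(1) = e/√2` for `n ≥ 1` (the Stirling sequence decreases). [folklore] -/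
theorem stirlingSeq_le_exp_one_div {n : ℕ} (hn : n ≠ 0) :
    Stirling.stirlingSeq n ≤ Real.exp 1 / Real.sqrt 2 := by
  obtain ⟨m, rfl⟩ := Nat.exists_eq_succ_of_ne_zero hn
  rw [← Stirling.stirlingSeq_one]
  exact Stirling.stirlingSeq'_antitone (Nat.zero_le m)

/-- `0 < s(n)` for `n ≥ 1`. [folklore] -/
theorem stirlingSeq_pos {n : ℕ} (hn : n ≠ 0) : 0 < Stirling.stirlingSeq n :=
  lt_of_lt_of_le (by positivity) (sqrt_pi_le_stirlingSeq' hn)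

/-- `0 < s(N)/(s(j) s(N-j))` for `1 ≤ j ≤ N - 1`. [folklore] -/
theorem stirlingRatio_pos {N j : ℕ} (hj : 1 ≤ j) (hjN : j + 1 ≤ N) : 0 < stirlingRatio N j := by
  unfold stirlingRatio
  exact div_pos (stirlingSeq_pos (by omega))
    (mul_pos (stirlingSeq_pos (by omega)) (stirlingSeq_pos (by omega)))

/-- The uniform bound `s(N)/(s(j) s(N-j)) ≤ e/(√2 π)` for `1 ≤ j ≤ N - 1` (Simon–Griffiths'
Lemma 2(a): `log C(N, (N+μ)/2) - G(N, μ)` is bounded). [cite: SimonGriffiths1973, §2 Lemma 2(a)] -/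
theorem stirlingRatio_le {N j : ℕ} (hj : 1 ≤ j) (hjN : j + 1 ≤ N) :
    stirlingRatio N j ≤ Real.exp 1 / (Real.sqrt 2 * π) := by
  unfold stirlingRatio
  have h1 := stirlingSeq_le_exp_one_div (n := N) (by omega)
  have h2 := sqrt_pi_le_stirlingSeq' (n := j) (by omega)
  have h3 := sqrt_pi_le_stirlingSeq' (n := N - j) (by omega)
  have hπ : 0 < Real.sqrt π := by positivity
  calc Stirling.stirlingSeq N / (Stirling.stirlingSeq j * Stirling.stirlingSeq (N - j))
      ≤ (Real.exp 1 / Real.sqrt 2) / (Real.sqrt π * Real.sqrt π) := by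
        gcongr
        exact (stirlingSeq_pos (by omega)).le
    _ = Real.exp 1 / (Real.sqrt 2 * π) := by
        rw [Real.mul_self_sqrt pi_pos.le, div_div]

/-- **Simon–Griffiths' Lemma 2(b)** in ratio form: `s(N)/(s(j) s(N-j)) → 1/√π` when `j → ∞` and
`N - j → ∞`. [cite: SimonGriffiths1973, §2 Lemma 2(b)] -/
theorem tendsto_stirlingRatio {ι : Type*} {l : Filter ι} {N j : ι → ℕ}
    (hj : Tendsto j l atTop) (hNj : Tendsto (fun i => N i - j i) l atTop) :
    Tendsto (fun i => stirlingRatio (N i) (j i)) l (𝓝 (1 / Real.sqrt π)) := by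
  have hN : Tendsto N l atTop :=
    tendsto_atTop_mono (fun i => Nat.sub_le (N i) (j i)) hNj
  have h1 := Stirling.tendsto_stirlingSeq_sqrt_pi.comp hN
  have h2 := Stirling.tendsto_stirlingSeq_sqrt_pi.comp hj
  have h3 := Stirling.tendsto_stirlingSeq_sqrt_pi.comp hNj
  have hπ : Real.sqrt π ≠ 0 := by positivity
  have e : 1 / Real.sqrt π = Real.sqrt π / (Real.sqrt π * Real.sqrt π) := by field_simp
  rw [e]
  exact h1.div (h2.mul h3) (mul_ne_zero hπ hπ)

/-- **Stirling form of a binomial coefficient** (Lemmas 1–2 of Simon–Griffiths): for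
`1 ≤ j ≤ N - 1`,
`C(N, j) = [s(N)/(s(j) s(N-j))] · √(N/(2 j (N-j))) · 2ᴺ · exp(-N h((2j-N)/N))`.
[cite: SimonGriffiths1973, §2 Lemma 2] -/
theorem choose_eq_stirlingRatio {N j : ℕ} (hj : 1 ≤ j) (hjN : j + 1 ≤ N) :
    (N.choose j : ℝ) = stirlingRatio N j * Real.sqrt (N / (2 * j * ((N : ℝ) - j))) *
      (2 ^ N * Real.exp (-(N * spinRate ((2 * j - N) / N)))) := by
  have hjle : j ≤ N := by omega
  have hNj : ((N - j : ℕ) : ℝ) = (N : ℝ) - j := Nat.cast_sub hjle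
  have hp : (0 : ℝ) < j := by exact_mod_cast hj
  have hq : (0 : ℝ) < (N : ℝ) - j := by rw [← hNj]; exact_mod_cast (show 0 < N - j by omega)
  have hN : (0 : ℝ) < N := by exact_mod_cast (show 0 < N by omega)
  rw [Nat.cast_choose ℝ hjle, factorial_eq_stirlingSeq_mul (n := N) (by omega),
    factorial_eq_stirlingSeq_mul (n := j) (by omega),
    factorial_eq_stirlingSeq_mul (n := N - j) (by omega), hNj, ← exp_entropy_eq hj hjN,
    stirlingRatio]
  have hs1 := stirlingSeq_pos (n := j) (by omega)
  have hs2 := stirlingSeq_pos (n := N - j) (by omega)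
  -- square roots: `√(2N) = √(N/(2j(N-j))) · √(2j) · √(2(N-j))`
  have hsq : Real.sqrt (2 * N) =
      Real.sqrt (N / (2 * j * ((N : ℝ) - j))) * (Real.sqrt (2 * j) * Real.sqrt (2 * ((N : ℝ) - j))) := by
    rw [← Real.sqrt_mul (by positivity), ← Real.sqrt_mul (by positivity)]
    congr 1
    field_simp
  -- exponentials: `exp(N log N - N) = exp(N log N - j log j - (N-j) log (N-j)) · exp(j log j - j) · exp(..)`
  have hexp : Real.exp (N * Real.log N - N) =
      Real.exp (N * Real.log N - j * Real.log j - ((N : ℝ) - j) * Real.log ((N : ℝ) - j)) *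
        (Real.exp (j * Real.log j - j) *
          Real.exp (((N : ℝ) - j) * Real.log ((N : ℝ) - j) - ((N : ℝ) - j))) := by
    rw [← Real.exp_add, ← Real.exp_add]
    congr 1
    ring
  rw [hsq, hexp]
  have h3 : Real.sqrt (2 * j) ≠ 0 := by positivity
  have h4 : Real.sqrt (2 * ((N : ℝ) - j)) ≠ 0 := by positivity
  field_simp

/-- `C(N, 0)`-type endpoints: `h(-1) = h(1) = log 2`. [folklore] -/
theorem spinRate_neg_one : spinRate (-1) = Real.log 2 := by
  rw [spinRate_neg, spinRate_one]

/-- **The crude entropy bound** `C(N, j) ≤ 2ᴺ exp(-N h((2j-N)/N))` for all `0 ≤ j ≤ N`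
(the term `m = j` of the binomial expansion of `1 = (j/N + (N-j)/N)ᴺ`; at `N = 0` both sides are
`1` with `0/0 = 0`). Compare the `binEntropy`-form lower-tail bound
`Literature.Combinatorics.vanLint_sum_choose_le_exp_binEntropy`. [folklore] -/
theorem choose_le_exp_spinRate {N j : ℕ} (hjN : j ≤ N) :
    (N.choose j : ℝ) ≤ 2 ^ N * Real.exp (-(N * spinRate ((2 * j - N) / N))) := by
  rcases Nat.eq_zero_or_pos N with rfl | hN
  · obtain rfl : j = 0 := Nat.le_zero.1 hjN
    simp
  have hN' : (0 : ℝ) < N := by exact_mod_cast hN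
  rcases Nat.eq_zero_or_pos j with rfl | hj
  · -- `j = 0`: both sides are `1`
    have : (2 * ((0 : ℕ) : ℝ) - N) / N = -1 := by simp [hN'.ne']
    rw [this, spinRate_neg_one, Nat.choose_zero_right, Nat.cast_one, neg_mul_eq_mul_neg,
      Real.exp_nat_mul, Real.exp_neg, Real.exp_log two_pos, inv_pow, mul_inv_cancel₀
      (pow_ne_zero N two_ne_zero)]
  rcases eq_or_lt_of_le hjN with rfl | hlt
  · -- `j = N`: both sides are `1`
    have : (2 * ((j : ℕ) : ℝ) - j) / j = 1 := by field_simp; ring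
    rw [this, spinRate_one, Nat.choose_self, Nat.cast_one, Real.exp_neg, Real.exp_nat_mul,
      Real.exp_log two_pos, mul_inv_cancel₀ (pow_ne_zero j two_ne_zero)]
  -- `1 ≤ j ≤ N - 1`: one term of the binomial expansion of `(p + q)ᴺ = 1`
  have hp : (0 : ℝ) < j := by exact_mod_cast hj
  have hq : (0 : ℝ) < (N : ℝ) - j := by
    have : (j : ℝ) < N := by exact_mod_cast hlt
    linarith
  set p : ℝ := j / N with hpdef
  set q : ℝ := ((N : ℝ) - j) / N with hqdef
  have hp0 : 0 < p := by positivity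
  have hq0 : 0 < q := by positivity
  have hpq : p + q = 1 := by rw [hpdef, hqdef]; field_simp; ring
  have hterm : p ^ j * q ^ (N - j) * (N.choose j : ℝ) ≤ 1 := by
    calc p ^ j * q ^ (N - j) * (N.choose j : ℝ)
        ≤ ∑ m ∈ Finset.range (N + 1), p ^ m * q ^ (N - m) * (N.choose m : ℝ) :=
          Finset.single_le_sum (f := fun m => p ^ m * q ^ (N - m) * (N.choose m : ℝ))
            (fun m _ => by positivity) (Finset.mem_range.2 (Nat.lt_succ_of_le hjN))
      _ = (p + q) ^ N := (add_pow p q N).symm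
      _ = 1 := by rw [hpq, one_pow]
  -- `pʲ qᴺ⁻ʲ = 2⁻ᴺ exp(N h(x))`
  have hpj : p ^ j * q ^ (N - j) = Real.exp (N * spinRate ((2 * j - N) / N)) / 2 ^ N := by
    have key := mul_log_add_mul_log_eq_spinRate hp (by exact_mod_cast hlt : (j : ℝ) < N)
    rw [hpdef, hqdef, div_pow, div_pow, ← Real.exp_log (pow_pos hp j),
      ← Real.exp_log (pow_pos hq (N - j)), ← Real.exp_log (pow_pos hN' j),
      ← Real.exp_log (pow_pos hN' (N - j)), Real.log_pow, Real.log_pow, Real.log_pow,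
      Real.log_pow, Nat.cast_sub hjN, eq_div_iff (pow_ne_zero N two_ne_zero),
      ← Real.exp_log (pow_pos two_pos N), Real.log_pow, ← Real.exp_sub, ← Real.exp_sub,
      ← Real.exp_add, ← Real.exp_add]
    congr 1
    linarith
  rw [hpj] at hterm
  have h2N : (0 : ℝ) < 2 ^ N := pow_pos two_pos N
  have hE : 0 < Real.exp (N * spinRate ((2 * j - N) / N)) := Real.exp_pos _
  rw [div_mul_eq_mul_div, div_le_one h2N] at hterm
  rw [Real.exp_neg, ← div_eq_mul_inv, le_div_iff₀ hE]
  linarith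

end Literature.Probability.LatticeModels
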